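/-
Copyright (c) 2026. All rights reserved.
Released under Apache 2.0 license as described in the file LICENSE.
Authors: abc-iut cell, statement-typer seat abc-iut-L4-t3 (wave 1).
-/
import Literature.AnabelianGeometry.AbsoluteAnabelian.GaloisTheaters
import Literature.AnabelianGeometry.AbsoluteAnabelian.MonoAnalyticLogShells
import HarnessLib

/-!
# [AbsTopIII] Definition 5.1 (iv), Corollary 5.2 (v), Definition 5.6 (i)–(ii): panalocal and mono-analytic Galois-theaters, `TB⊞`

S. Mochizuki, *Topics in absolute anabelian geometry III: global reconstruction algorithms*,
J. Math. Sci. Univ. Tokyo 22 (2015) 939–1156 [MochizukiAbsTopIII2015]; locators `p.N` = pages of the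
author's manuscript (`paper:url-5493eb38cbb7`; journal pagination not held), read on the page: Def 5.1 (iv)
p. 116, Cor 5.2 (v) p. 120, Def 5.6 (i) p. 134, (ii) p. 135.

## What is typed and how (statements-first; layer policy plan/L4/ASSIGNMENTS.md §2)

Over a `GlobalAnabelianContext R` (`GaloisTheaters.lean`):
* the `Aut(Π)`-action on `V⊚(Π)` ("`Aut(Π_X)` acts naturally on all of these objects", Def 5.1 (ii)) is the
  relation `R.AutRel` induced by the automorphisms of `EA⊚` through `R.mapProVal`; `V⊚(Π)/Aut(Π)` is the
  quotient `R.ProValModAut`;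
* Def 5.1 (iv): `PanalocalGaloisTheater R` — a SET `V⊚ = {⊚} ∪ V^non ∪ V^arc`, a profinite group `Π_v` for
  each `v ∈ V^non` (an object of `Orb(TG)`), an Aut-holomorphic orbispace `X_v` for each `v ∈ V^arc`, such that
  a reference bijection `ψ_V : V⊚(Π)/Aut(Π) ≅ V⊚` with (a), (b), (c) EXISTS; morphisms; the panalocalization of
  the canonical theaters `Π ↦ V✠(Π)` (object map of `Th⊚ → Th✠`) characterised by `IsPanalocalizationOf`;
* Def 5.1 (iv) / Cor 5.2 (v), morphism part (weak form: `EA⊚`-morphisms induce morphisms of panalocalizations) and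
  the object part (`PanalocalizationExists`) as named `Prop` facts; Rmk 5.2.1 and the full faithfulness of Cor 5.2 (v)
  are NOT typed (they need the panalocalization as a constructed functor);
* Def 5.6 (ii): `MonoAnalyticGaloisTheater` — a set `W⊚ = {⊚} ∪ W^non ∪ W^arc`, `(G_w, |Π|_w)` for
  `w ∈ W^non` (`G_w ∈ Ob(Orb(TG⊢))`, `|Π|_w` an isomorphism class, modelled as an isomorphism-closed predicate
  on profinite groups), `(G_w, |X|_w)` for `w ∈ W^arc` (`G_w ∈ Ob(Orb(TM⊢))`), such that a reference bijection
  from some panalocal Galois-theater with (a), (b), (c) EXISTS; morphisms. The mono-analyticization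
  `X ↦ (𝒪^▷_{A_X}, 𝒪^▷_{A_X} ∩ ℝ_{>0}) ∈ Ob(TM⊢)` of an Aut-holomorphic orbispace (Def 5.6 (ii)(c); owner of
  `EA`: abc-iut-L4-t2) enters as the interface `ArchMonoAnalyticization` (TODO-merge abc-iut-L4-t2).

Modelling notes for the referee: objects of `Orb(−)` carry the same data as objects of the underlying
category (orbi-ness affects morphisms only), so `Π_v`, `G_w` are plain profinite groups / `TM⊢`-objects and
the "[orbi-]" open injections of morphisms are recorded by representatives; "`G_w` is isomorphic to the
quotient `Π_v ↠ G_v` determined by the absolute Galois group of the base field" uses `G_v := aug(Π_v) ⊆ G`.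
NOT here: panalocal `T`-pairs (Def 5.1 (vi)), Def 5.6 (iii)–(iv), the essential surjectivity of
`Th⊚ → Th✠` / `Th✠ → Th⊢` (stated with those files). Refereed pre-IUT anabelian geometry; nothing here bears
on [IUTchIII] Cor. 3.12; typed ≠ discharged.
-/

set_option autoImplicit false

universe u

open CategoryTheory Topology

namespace Literature.AnabelianGeometry.AbsoluteAnabelian

namespace GlobalAnabelianContext

variable (R : GlobalAnabelianContext.{u})

/-- the relation "`w = α · v` for some automorphism `α ∈ Aut(Π)`" on `V⊚(Π)` (`Aut(Π)` acting through the
functoriality `R.mapProVal` of `V⊚(−)` in isomorphisms of `EA⊚`). [cite: MochizukiAbsTopIII2015, Def 5.1 (ii) p. 115] -/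
def AutRel (E : FundamentalExtension.{u}) (v w : (R.proVal E).carrier) : Prop :=
  ∃ (α : E ≅ E) (hα : IsEAHom α.hom), R.mapProVal α.hom hα v = w

/-- `V⊚(Π)/Aut(Π)` (in natural bijection with `V⊚(F_mod)`, Def 5.1 (ii)).
[cite: MochizukiAbsTopIII2015, Def 5.1 (ii) p. 115] -/
def ProValModAut (E : FundamentalExtension.{u}) : Type u := Quot (R.AutRel E)

/-- the class of `v ∈ V⊚(Π)` in `V⊚(Π)/Aut(Π)`. [cite: MochizukiAbsTopIII2015, Def 5.1 (ii) p. 115] -/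
def toModAut (E : FundamentalExtension.{u}) (v : (R.proVal E).carrier) : R.ProValModAut E :=
  Quot.mk _ v

/-- `G_v := aug(Π_v) ⊆ G`: the quotient of the decomposition group `Π_v` "determined by the absolute Galois group
of the base field" (the decomposition group of `v` in `G_F`). [cite: MochizukiAbsTopIII2015, Def 5.6 (ii) p. 135] -/
def galDecomp (E : FundamentalExtension.{u}) (v : (R.proVal E).carrier) : Subgroup E.gal :=
  ((R.proVal E).decomp v).map E.aug.toMonoidHom

/-- `Π_v` as a profinite group (a closed subgroup of `Π`). [cite: MochizukiAbsTopIII2015, Def 5.1 (iv) p. 116] -/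
noncomputable def decompGrp (E : FundamentalExtension.{u}) (v : (R.proVal E).carrier) : ProfiniteGrp.{u} :=
  ProfiniteGrp.ofClosedSubgroup ⟨(R.proVal E).decomp v, (R.proVal E).isClosed_decomp v⟩

/-- `G_v` as a profinite group (the image of the compact `Π_v` in `G` is closed).
[cite: MochizukiAbsTopIII2015, Def 5.6 (ii) p. 135] -/
noncomputable def galDecompGrp (E : FundamentalExtension.{u}) (v : (R.proVal E).carrier) : ProfiniteGrp.{u} :=
  ProfiniteGrp.ofClosedSubgroup ⟨R.galDecomp E v, by
    have h : IsCompact (E.aug '' ((R.proVal E).decomp v : Set E.arith)) :=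
      (((R.proVal E).isClosed_decomp v).isCompact).image (map_continuous E.aug)
    exact h.isClosed⟩

/-- `Π_v ×_G U` for an open subgroup `U ⊆ G`: the open subgroups of `Π_v` "arising from open subgroups of `G_v`"
(a cofinal system of them), as profinite groups. [cite: MochizukiAbsTopIII2015, Def 5.6 (ii) p. 135] -/
noncomputable def decompRestrict (E : FundamentalExtension.{u}) (v : (R.proVal E).carrier) (U : Subgroup E.gal)
    (hU : IsOpen (U : Set E.gal)) : ProfiniteGrp.{u} :=
  ProfiniteGrp.ofClosedSubgroup ⟨(R.proVal E).decomp v ⊓ U.comap E.aug.toMonoidHom, by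
    change IsClosed (((R.proVal E).decomp v : Set E.arith) ∩ E.aug ⁻¹' (U : Set E.gal))
    exact ((R.proVal E).isClosed_decomp v).inter ((U.isClosed_of_isOpen hU).preimage (map_continuous E.aug))⟩

end GlobalAnabelianContext

/-! ## Def 5.1 (iv): panalocal Galois-theaters -/

section

variable (R : GlobalAnabelianContext.{u})

/-- Conditions (a), (b), (c) of Def 5.1 (iv) on a candidate reference bijection `ψ : V⊚(Π)/Aut(Π) ≅ V⊚` for the
data `(V⊚ = {⊚} ∪ V^non ∪ V^arc, {Π_v}, {X_v})`: (a) `⊚ ↦ ⊚`, `V(Π)^non ↠ V^non`, `V(Π)^arc ↠ V^arc`; (b) each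
`Π_v` is isomorphic to the decomposition group `Π_vl ⊆ Π` of some `vl` over `v`; (c) each `X_v` is isomorphic to
`X(Π, vl)` for some `vl` over `v`. [cite: MochizukiAbsTopIII2015, Def 5.1 (iv) p. 116] -/
def IsPanalocalReferenceFor {V : Type u} (generic : V) (non arc : Set V) (grp : non → ProfiniteGrp.{u})
    (X : arc → AutHolOrbispace.{u}) (E : FundamentalExtension.{u}) (ψ : R.ProValModAut E ≃ V) : Prop :=
  ψ (R.toModAut E (R.proVal E).generic) = generic ∧
    (∀ v, v ∈ (R.proVal E).non → ψ (R.toModAut E v) ∈ non) ∧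
    (∀ v, v ∈ (R.proVal E).arc → ψ (R.toModAut E v) ∈ arc) ∧
    (∀ v : non, ∃ vl : (R.proVal E).carrier, vl ∈ (R.proVal E).non ∧ ψ (R.toModAut E vl) = v ∧
      Nonempty (grp v ≃ₜ* R.decompGrp E vl)) ∧
    (∀ v : arc, ∃ vl : (R.proVal E).arc, ψ (R.toModAut E vl) = v ∧
      Nonempty (AutHolOrbispace.Iso (X v) (R.archSpace E vl)))

/-- A **panalocal Galois-theater** `V✠ = (V⊚, {Π_v}_{v ∈ V^non}, {X_v}_{v ∈ V^arc})`: a SET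
`V⊚ = {⊚_V} ∪ V^non ∪ V^arc`; `Π_v ∈ Ob(Orb(TG))` for `v ∈ V^non`; `X_v ∈ Ob(Orb(EA))` for `v ∈ V^arc` — such that
there exist `Π ∈ Ob(EA⊚)` and a reference bijection `ψ_V : V⊚(Π)/Aut(Π) ≅ V⊚` with (a), (b), (c).
[cite: MochizukiAbsTopIII2015, Def 5.1 (iv) p. 116] -/
structure PanalocalGaloisTheater : Type (u + 1) where
  /-- the underlying set `V⊚` -/
  V : Type u
  /-- `⊚_V` -/
  generic : V
  /-- `V^non` -/
  non : Set V
  /-- `V^arc` -/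
  arc : Set V
  /-- `⊚ ∉ V^non` -/
  generic_notMem_non : generic ∉ non
  /-- `⊚ ∉ V^arc` -/
  generic_notMem_arc : generic ∉ arc
  /-- `V^non ∩ V^arc = ∅` -/
  disjoint_non_arc : Disjoint non arc
  /-- `V⊚ = {⊚} ∪ V^non ∪ V^arc` -/
  eq_generic_or_mem (v : V) : v = generic ∨ v ∈ non ∨ v ∈ arc
  /-- `Π_v ∈ Ob(Orb(TG))`, `v ∈ V^non` -/
  grp : non → ProfiniteGrp.{u}
  /-- `X_v ∈ Ob(Orb(EA))`, `v ∈ V^arc` -/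
  X : arc → AutHolOrbispace.{u}
  /-- existence of `Π ∈ Ob(EA⊚)` and a reference bijection `ψ_V : V⊚(Π)/Aut(Π) ≅ V⊚` with (a), (b), (c) -/
  exists_reference : ∃ (E : FundamentalExtension.{u}) (_ : R.IsAdmissible E) (ψ : R.ProValModAut E ≃ V),
    IsPanalocalReferenceFor R generic non arc grp X E ψ

end

namespace PanalocalGaloisTheater

variable {R : GlobalAnabelianContext.{u}}

/-- A **morphism of panalocal Galois-theaters**: a bijection `φ_V : V⊚₁ ≅ V⊚₂` inducing `V^non₁ ≅ V^non₂`,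
`V^arc₁ ≅ V^arc₂`, together with open injections of [orbi-]profinite groups `(Π₁)_{v₁} ↪ (Π₂)_{v₂}` and
isomorphisms of [orbi-]Aut-holomorphic orbispaces `(X₁)_{v₁} ≅ (X₂)_{v₂}` (representatives of the
orbi-morphisms; their existence is what we record). [cite: MochizukiAbsTopIII2015, Def 5.1 (iv) p. 116] -/
structure Hom (T₁ T₂ : PanalocalGaloisTheater R) : Type u where
  /-- `φ_V` -/
  φV : T₁.V ≃ T₂.V
  /-- `⊚ ↦ ⊚` -/
  φV_generic : φV T₁.generic = T₂.generic
  /-- `V^non₁ ≅ V^non₂` -/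
  image_non : φV '' T₁.non = T₂.non
  /-- `V^arc₁ ≅ V^arc₂` -/
  image_arc : φV '' T₁.arc = T₂.arc
  /-- (bookkeeping) nonarchimedean elements go to nonarchimedean elements -/
  non_mem : ∀ v : T₁.non, φV v ∈ T₂.non
  /-- (bookkeeping) archimedean elements go to archimedean elements -/
  arc_mem : ∀ v : T₁.arc, φV v ∈ T₂.arc
  /-- the open injection `(Π₁)_{v₁} ↪ (Π₂)_{v₂}` (DATA: a representative of the orbi-morphism) -/
  grpHom : ∀ v : T₁.non, T₁.grp v →ₜ* T₂.grp ⟨φV v, non_mem v⟩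
  /-- it is an open injection -/
  grpHom_isOpenInjection : ∀ v : T₁.non, IsOpenInjection (grpHom v)
  /-- the isomorphism `(X₁)_{v₁} ≅ (X₂)_{v₂}` (DATA) -/
  archIso : ∀ v : T₁.arc, AutHolOrbispace.Iso (T₁.X v) (T₂.X ⟨φV v, arc_mem v⟩)

/-- "`V✠` is a panalocalization of `V⊚(Π)`": the reference data of Def 5.1 (iv) realised with THIS `Π` — the value
at `Π` of the panalocalization functor `Th⊚ → Th✠` ("follows immediately from the definitions; essentially
surjective"), up to isomorphism. [cite: MochizukiAbsTopIII2015, Def 5.1 (iv) p. 116] -/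
def IsPanalocalizationOf (P : PanalocalGaloisTheater R) (E : FundamentalExtension.{u}) : Prop :=
  ∃ (_ : R.IsAdmissible E) (ψ : R.ProValModAut E ≃ P.V), IsPanalocalReferenceFor R P.generic P.non P.arc P.grp P.X E ψ

/-- the panalocalization functor is essentially surjective BY DEFINITION: every panalocal Galois-theater is a
panalocalization of some `V⊚(Π)`. [cite: MochizukiAbsTopIII2015, Def 5.1 (iv) p. 116] -/
theorem exists_isPanalocalizationOf (P : PanalocalGaloisTheater R) : ∃ E, P.IsPanalocalizationOf E := by
  obtain ⟨E, hE, ψ, h⟩ := P.exists_reference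
  exact ⟨E, hE, ψ, h⟩

end PanalocalGaloisTheater

/-- **Def 5.1 (iv) / Cor 5.2 (v), object part** (named fact): for every `Π ∈ Ob(EA⊚)` the panalocalization
`V✠(Π) = (Π, {V⊚(Π)}✠)` exists, i.e. some panalocal Galois-theater is a panalocalization of `V⊚(Π)` (its
underlying set is `V⊚(Π)/Aut(Π)`, `Π_v` = decomposition groups of lifts, `X_v = X(Π, ṽ)`). An assumption on
`R` (true for the context of Thm 1.9 / Cor 2.8: there `Aut(Π)` preserves `⊚`, `V^non`, `V^arc`).
[cite: MochizukiAbsTopIII2015, Cor 5.2 (v) p. 120] -/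
def PanalocalizationExists (R : GlobalAnabelianContext.{u}) : Prop :=
  ∀ E : FundamentalExtension.{u}, R.IsAdmissible E → ∃ P : PanalocalGaloisTheater R, P.IsPanalocalizationOf E

/-- **Def 5.1 (iv) / Cor 5.2 (v), morphism part, WEAK FORM** (named fact; assumption on `R`): morphisms of `EA⊚`
induce morphisms between panalocalizations ("we obtain a natural panalocalization functor `Th⊚ → Th✠`", p. 116). The
full-faithfulness assertion of Cor 5.2 (v) ("the first arrow `EA⊚ → An⊚[Th✠]` is an equivalence") would in addition say
that every morphism between panalocalizations remembering `Π₁, Π₂` arises from a UNIQUE morphism of `EA⊚`; stating it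
needs the panalocalization as a constructed functor (TODO(general form)), so only existence is typed here. Rmk 5.2.1
("neither `EA⊚ → Th✠` nor `EA⊚ → Th✠_T` is an equivalence") is likewise not typed in this file.
[cite: MochizukiAbsTopIII2015, Def 5.1 (iv) p. 116] -/
def PanalocalizationMapsHom (R : GlobalAnabelianContext.{u}) : Prop :=
  ∀ (E₁ E₂ : FundamentalExtension.{u}) (P₁ P₂ : PanalocalGaloisTheater R),
    P₁.IsPanalocalizationOf E₁ → P₂.IsPanalocalizationOf E₂ →
    ∀ f : E₁ ⟶ E₂, IsEAHom f → Nonempty (PanalocalGaloisTheater.Hom P₁ P₂)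

/-! ## Def 5.6 (i): the category `TB⊞` -/

/-- An object `(B, B′, B″, β)` of `TB⊞` (Def 5.6 (i)): "a two-dimensional connected topological Lie group `B` equipped
with two one-parameter subgroups `B′, B″ ⊆ B` that determine an isomorphism `B′ × B″ ≅ B` of topological groups,
together with an isomorphism `β : Lie±(B′) ≅ Lie±(B″)`" of orbi-group germs. MODELLING (for the referee): `B` is an
abelian topological group; the one-parameter subgroups are recorded by continuous homomorphisms `c₁, c₂ : ℝ → B`
(images `B′ = c₁(ℝ)`, `B″ = c₂(ℝ)`; e.g. `B′ ≅ S¹`, `B″ ≅ ℝ` in the model `Lie(ℂ^×) ≅ S¹ × ℝ_{>0}` of Def 5.6 (iv)), with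
`B′ ∩ B″ = {0}`, `(s, t) ↦ c₁(s) + c₂(t)` surjective and open (so `B′ × B″ ≅ B` is a bijective open continuous
homomorphism — the printed isomorphism of topological groups; connectedness and two-dimensionality follow);
the germ isomorphism `β : Lie±(B′) ≅ Lie±(B″)` is recorded, relative to the parametrisations, by a POSITIVE SCALAR `β`
(`c₁(s) ↦ c₂(β s)` near `0`, up to the built-in `±1`). Morphisms of `TB⊞`: surjective homomorphisms compatible with
`B′, B″, β`; the decomposition functor `dec : TB⊞ → TG × TG^cs`, `(B, B′, B″, β) ↦ (B′, (B″)^cs)`.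
[cite: MochizukiAbsTopIII2015, Def 5.6 (i) p. 134] -/
structure TBPlus : Type (u + 1) where
  /-- the group `B` -/
  B : Type u
  /-- abelian group structure -/
  [instAdd : AddCommGroup B]
  /-- topology -/
  [top : TopologicalSpace B]
  /-- topological group -/
  [topGrp : IsTopologicalAddGroup B]
  /-- the one-parameter subgroup `B′`, parametrised -/
  c₁ : ℝ →ₜ+ B
  /-- the one-parameter subgroup `B″`, parametrised -/
  c₂ : ℝ →ₜ+ B
  /-- the parametrisations are nonconstant near `0` (genuine one-parameter subgroups) -/
  exists_injOn : ∃ ε : ℝ, 0 < ε ∧ Set.InjOn c₁ (Set.Ioo (-ε) ε) ∧ Set.InjOn c₂ (Set.Ioo (-ε) ε)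
  /-- `B′ ∩ B″ = {0}` (so `B′ × B″ → B`, `(x, y) ↦ x + y`, is injective) … -/
  add_injective : ∀ s t : ℝ, c₁ s = c₂ t → c₁ s = 0
  /-- … surjective … -/
  add_surjective : Function.Surjective fun p : ℝ × ℝ => c₁ p.1 + c₂ p.2
  /-- … and a local homeomorphism at `0` ("determine an isomorphism `B′ × B″ ≅ B` of topological groups";
  `B` two-dimensional) -/
  isOpenMap_add : IsOpenMap fun p : ℝ × ℝ => c₁ p.1 + c₂ p.2
  /-- the germ isomorphism `β : Lie±(B′) ≅ Lie±(B″)` as a positive scalar relative to `c₁, c₂` -/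
  β : ℝ
  /-- positivity (the sign is absorbed by `Lie±`) -/
  β_pos : 0 < β

attribute [instance] TBPlus.instAdd TBPlus.top TBPlus.topGrp

/-- a morphism `(B₁, B′₁, B″₁, β₁) → (B₂, B′₂, B″₂, β₂)` of `TB⊞`: a surjective continuous homomorphism `B₁ → B₂`
carrying the one-parameter subgroups to the one-parameter subgroups (with rescaled parameters `a₁, a₂`) and compatible
with the germ isomorphisms up to sign (`|a₂|·β₁ = β₂·|a₁|`). [cite: MochizukiAbsTopIII2015, Def 5.6 (i) p. 134] -/
structure TBPlus.Hom (M₁ M₂ : TBPlus.{u}) : Type u where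
  /-- the homomorphism -/
  toHom : M₁.B →ₜ+ M₂.B
  /-- surjective -/
  surjective : Function.Surjective toHom
  /-- rescaling of the `B′`-parameter -/
  a₁ : ℝ
  /-- rescaling of the `B″`-parameter -/
  a₂ : ℝ
  /-- `B′₁ → B′₂` -/
  map_c₁ : ∀ s : ℝ, toHom (M₁.c₁ s) = M₂.c₁ (a₁ * s)
  /-- `B″₁ → B″₂` -/
  map_c₂ : ∀ s : ℝ, toHom (M₁.c₂ s) = M₂.c₂ (a₂ * s)
  /-- compatibility with `β₁, β₂` up to the sign indeterminacy of `Lie±` -/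
  map_β : |a₂| * M₁.β = M₂.β * |a₁|

/-! ## Def 5.6 (ii): mono-analytic Galois-theaters -/

/-- INTERFACE (TODO-merge abc-iut-L4-t2, owner of `EA` and of Def 4.1): the mono-analyticization of an
Aut-holomorphic orbispace, `X ↦ (𝒪^▷_{A_X}, 𝒪^▷_{A_X} ∩ ℝ_{>0}) ∈ Ob(TM⊢)` (Def 5.6 (ii)(c); the functor
`EA → TM⊢` of Def 5.9 (i)), with its action on isomorphisms. [cite: MochizukiAbsTopIII2015, Def 5.6 (ii) p. 135] -/
structure ArchMonoAnalyticization : Type (u + 1) where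
  /-- `X ↦ (𝒪^▷_{A_X}, 𝒪^▷_{A_X} ∩ ℝ_{>0})` -/
  toTMMono : AutHolOrbispace.{u} → TMMono.{u}
  /-- functoriality on isomorphisms -/
  mapIso : ∀ {X Y : AutHolOrbispace.{u}}, AutHolOrbispace.Iso X Y → TMMono.Iso (toTMMono X) (toTMMono Y)

section

variable (R : GlobalAnabelianContext.{u}) (ma : ArchMonoAnalyticization.{u})

/-- Conditions (a), (b), (c) of Def 5.6 (ii) on a candidate reference bijection `ψ_W : V⊚ ≅ W⊚` from a panalocal
Galois-theater `V✠` (with a reference `Π`, `ψ_V` of its own, used to name the canonical quotients `Π_v ↠ G_v`):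
(a) `⊚ ↦ ⊚`, `non ≅ non`, `arc ≅ arc`; (b) for `v ↦ w` nonarchimedean, `G_w ≅ G_v` ("the quotient `Π_v ↠ G_v`
determined by the absolute Galois group of the base field") and `|Π|_w` contains the open subgroups of `Π_v`
arising from open subgroups of `G_v`; (c) for `v ↦ w` archimedean, `X_v ∈ |X|_w` and
`G_w ≅ (𝒪^▷_{A_{X_v}}, 𝒪^▷_{A_{X_v}} ∩ ℝ_{>0})`. [cite: MochizukiAbsTopIII2015, Def 5.6 (ii) p. 135] -/
def IsMonoAnalyticReferenceFor {W : Type u} (generic : W) (non arc : Set W)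
    (G : non → ProfiniteGrp.{u}) (piClass : non → ProfiniteGrp.{u} → Prop)
    (M : arc → TMMono.{u}) (xClass : arc → AutHolOrbispace.{u} → Prop)
    (P : PanalocalGaloisTheater R) (ψ : P.V ≃ W) : Prop :=
  ψ P.generic = generic ∧ ψ '' P.non = non ∧ ψ '' P.arc = arc ∧
    (∃ (E : FundamentalExtension.{u}) (_ : R.IsAdmissible E) (ψP : R.ProValModAut E ≃ P.V),
      IsPanalocalReferenceFor R P.generic P.non P.arc P.grp P.X E ψP ∧
      ∀ (v : P.non) (hw : ψ v ∈ non), ∃ vl : (R.proVal E).carrier, vl ∈ (R.proVal E).non ∧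
        ψP (R.toModAut E vl) = v ∧ Nonempty (G ⟨ψ v, hw⟩ ≃ₜ* R.galDecompGrp E vl) ∧
        ∀ (U : Subgroup E.gal) (hU : IsOpen (U : Set E.gal)), piClass ⟨ψ v, hw⟩ (R.decompRestrict E vl U hU)) ∧
    (∀ (v : P.arc) (hw : ψ v ∈ arc),
      xClass ⟨ψ v, hw⟩ (P.X v) ∧ Nonempty (TMMono.Iso (M ⟨ψ v, hw⟩) (ma.toTMMono (P.X v))))

/-- A **mono-analytic Galois-theater** `W⊢ = (W⊚, {(G_w, |Π|_w)}_{w ∈ W^non}, {(G_w, |X|_w)}_{w ∈ W^arc})`: a set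
`W⊚ = {⊚_W} ∪ W^non ∪ W^arc`; for `w ∈ W^non`, `G_w ∈ Ob(Orb(TG⊢))` and `|Π|_w` "an isomorphism class of
pro-objects of `TG`" (modelled as an isomorphism-closed predicate on profinite groups); for `w ∈ W^arc`,
`G_w ∈ Ob(Orb(TM⊢))` and `|X|_w` an isomorphism class of `EA` (an isomorphism-closed predicate) — such that a
panalocal Galois-theater `V✠` and a reference bijection `ψ_W : V⊚ ≅ W⊚` with (a), (b), (c) EXIST.
[cite: MochizukiAbsTopIII2015, Def 5.6 (ii) p. 135] -/
structure MonoAnalyticGaloisTheater : Type (u + 1) where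
  /-- the underlying set `W⊚` -/
  W : Type u
  /-- `⊚_W` -/
  generic : W
  /-- `W^non` -/
  non : Set W
  /-- `W^arc` -/
  arc : Set W
  /-- `⊚ ∉ W^non` -/
  generic_notMem_non : generic ∉ non
  /-- `⊚ ∉ W^arc` -/
  generic_notMem_arc : generic ∉ arc
  /-- `W^non ∩ W^arc = ∅` -/
  disjoint_non_arc : Disjoint non arc
  /-- `W⊚ = {⊚} ∪ W^non ∪ W^arc` -/
  eq_generic_or_mem (w : W) : w = generic ∨ w ∈ non ∨ w ∈ arc
  /-- `G_w ∈ Ob(Orb(TG⊢))`, `w ∈ W^non` -/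
  G : non → ProfiniteGrp.{u}
  /-- `G_w` is of MLF-Galois type -/
  isMLFGaloisType : ∀ w, IsMLFGaloisType (G w)
  /-- `|Π|_w`, `w ∈ W^non` -/
  piClass : non → ProfiniteGrp.{u} → Prop
  /-- `|Π|_w` is isomorphism-closed -/
  piClass_iso : ∀ (w : non) {D D' : ProfiniteGrp.{u}}, Nonempty (D ≃ₜ* D') → piClass w D → piClass w D'
  /-- `G_w ∈ Ob(Orb(TM⊢))`, `w ∈ W^arc` -/
  M : arc → TMMono.{u}
  /-- `|X|_w`, `w ∈ W^arc` -/
  xClass : arc → AutHolOrbispace.{u} → Prop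
  /-- `|X|_w` is isomorphism-closed -/
  xClass_iso : ∀ (w : arc) {X X' : AutHolOrbispace.{u}}, Nonempty (AutHolOrbispace.Iso X X') →
    xClass w X → xClass w X'
  /-- existence of a panalocal Galois-theater `V✠` and a reference bijection `ψ_W` with (a), (b), (c) -/
  exists_reference : ∃ (P : PanalocalGaloisTheater R) (ψ : P.V ≃ W),
    IsMonoAnalyticReferenceFor R ma generic non arc G piClass M xClass P ψ

end

namespace MonoAnalyticGaloisTheater

variable {R : GlobalAnabelianContext.{u}} {ma : ArchMonoAnalyticization.{u}}

/-- A **morphism of mono-analytic Galois-theaters**: a bijection `φ_W : W⊚₁ ≅ W⊚₂` inducing `W^non₁ ≅ W^non₂`,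
`W^arc₁ ≅ W^arc₂`, compatible with the classes `|Π|_w`, `|X|_w`, together with open injections of
[orbi-]profinite groups `(G₁)_{w₁} ↪ (G₂)_{w₂}` (nonarchimedean) and isomorphisms `(G₁)_{w₁} ≅ (G₂)_{w₂}` in `TM⊢`
(archimedean). [cite: MochizukiAbsTopIII2015, Def 5.6 (ii) p. 135] -/
structure Hom (T₁ T₂ : MonoAnalyticGaloisTheater R ma) : Type u where
  /-- `φ_W` -/
  φW : T₁.W ≃ T₂.W
  /-- `⊚ ↦ ⊚` -/
  φW_generic : φW T₁.generic = T₂.generic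
  /-- `W^non₁ ≅ W^non₂` -/
  image_non : φW '' T₁.non = T₂.non
  /-- `W^arc₁ ≅ W^arc₂` -/
  image_arc : φW '' T₁.arc = T₂.arc
  /-- compatibility with `|Π|_w` and the open injection `(G₁)_{w₁} ↪ (G₂)_{w₂}` -/
  non_compat : ∀ w : T₁.non, ∃ hw : φW w ∈ T₂.non,
    (∀ D, T₁.piClass w D ↔ T₂.piClass ⟨φW w, hw⟩ D) ∧ ∃ f : T₁.G w →ₜ* T₂.G ⟨φW w, hw⟩, IsOpenInjection f
  /-- compatibility with `|X|_w` and the isomorphism `(G₁)_{w₁} ≅ (G₂)_{w₂}` -/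
  arc_compat : ∀ w : T₁.arc, ∃ hw : φW w ∈ T₂.arc,
    (∀ X, T₁.xClass w X ↔ T₂.xClass ⟨φW w, hw⟩ X) ∧ Nonempty (TMMono.Iso (T₁.M w) (T₂.M ⟨φW w, hw⟩))

/-- "`W⊢` is a mono-analyticization of `V✠`" (the value of the mono-analyticization functor `Th✠ → Th⊢`, up to
isomorphism). [cite: MochizukiAbsTopIII2015, Def 5.6 (ii) p. 135] -/
def IsMonoAnalyticizationOf (T : MonoAnalyticGaloisTheater R ma) (P : PanalocalGaloisTheater R) : Prop :=
  ∃ ψ : P.V ≃ T.W, IsMonoAnalyticReferenceFor R ma T.generic T.non T.arc T.G T.piClass T.M T.xClass P ψ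

/-- `Th✠ → Th⊢` is essentially surjective BY DEFINITION. [cite: MochizukiAbsTopIII2015, Def 5.6 (ii) p. 135] -/
theorem exists_isMonoAnalyticizationOf (T : MonoAnalyticGaloisTheater R ma) :
    ∃ P : PanalocalGaloisTheater R, T.IsMonoAnalyticizationOf P :=
  T.exists_reference

end MonoAnalyticGaloisTheater

/-- **Def 5.6 (ii), the mono-analyticization functors `Th✠ → Th⊢`, `Th✠[Z] → Th⊢[Z]`, object part** (named fact):
every panalocal Galois-theater admits a mono-analyticization (`W⊚ := V⊚`, `G_w :=` the quotient `Π_v ↠ G_v`,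
`|Π|_w`, `G_w := (𝒪^▷_{A_{X_v}}, …)`, `|X|_w :=` the class of `X_v`). An assumption on `(R, ma)`, true for the
genuine context (it needs `G_v` to be of MLF-Galois type). [cite: MochizukiAbsTopIII2015, Def 5.6 (ii) p. 135] -/
def MonoAnalyticizationExists (R : GlobalAnabelianContext.{u}) (ma : ArchMonoAnalyticization.{u}) : Prop :=
  ∀ P : PanalocalGaloisTheater R, ∃ T : MonoAnalyticGaloisTheater R ma, T.IsMonoAnalyticizationOf P

end Literature.AnabelianGeometry.AbsoluteAnabelian
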